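import Summits.HodgeConjecture.CorCM.Census.OcticTwistHalfParity
import Summits.HodgeConjecture.CorCM.Census.OcticTwistSandwich

/-!
# The octic twist `(ℤ/8 × B, (4,0))`, XXIII: THE LAW WITHOUT SCREW PAIR TYPES — `μ(ℤ/8 × B, (4,0)) = β − 1` for every finite group `B`
# of order `≥ 3` without elements of order divisible by `8`

COR-CM (cell `pub-hodgecm2`), count-neutral kernel combinatorics by the binder seat b09 (gen 34; lane COINVARIANT-TWIST / OCTIC RECON), on top of
part XXII (`exists_parity₂`, `eight_dvd_of_screw₂`, `fpar₂`, `fpar₂_pairVec₂`, `fpar₂_transl₂_of_mem_hodge₂`, `fpar₂_W`), part XV / XXI (`parVec₂`, `blkA`, `blkC`,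
`parVec₂_X`, `parVec₂_Dmove`, `parVec₂_ccSquare`, `parVec₂_rel`, `card_residual_blocks_le_ten`, `card_orb₂_le_card_add_one`) and part XX
(`exists_faces_generate₂_all`) BY NAME; the pattern is gen 32ʼs `Census/QuarticTwistNoScrew.lean` one dimension up.
One bookkeeping definition (`parF₂`, the half-parity joined with the block parities) + theorems; no certificate, no named fact, no `sorry`.
HONEST FRAMING: `HC_CM` is NOT proved, here or anywhere in the tree; nothing here is a period or a headline.

* §1 `parF₂` and the span bound: for a family `S ⊆ hodge₂` the values `(f, parities)` of `pairs₂ ⊔ ℤ[G]·S` lie in the `𝔽₂`-span of those of `S`.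
* §2 **`card_orb₂_le_card_add_one_of_noScrew_even`** (`|B|` even `≥ 4`, no screw pair type): every family `S ⊆ hodge₂` whose motions generate
  `hodge₂` modulo `pairs₂` has `β ≤ |S| + 1` — the eight parity vectors of part XXI and the Weil lift `w_1 ⊗ e_0` (zero block parities,
  `f = 1`) have independent `(parities, f)`-values.  §3 joins the odd case (part XV): **`card_orb₂_le_card_add_one_of_noScrew`**.
* §4 **`octicTwist_law_noScrew`** (with part XXIIʼs `eight_dvd_of_screw₂`) (`|B| ≥ 3`, `8 ∤ ord t` for all `t ∈ B`): (i) a family of EXACTLY `β − 1` octic rank-four faces generates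
  `hodge₂` modulo `pairs₂` under the motions, and (ii) no family of fewer HODGE vectors does: **`μ_hodge(ℤ/8 × B, (4,0)) = β − 1`** — the value
  `φ₂` of the twist fibre law (`Census/CoinvariantTwistLaw.lean`, `j = 2`, `δ = 0`).  The screw case (`∃ t, 8 ∣ ord t`: `μ = β − 2` expected,
  as in the quartic part XV) is the successor part; §5 records that screw pair types exist iff `∃ t ∈ B, 8 ∣ ord t` (`screw₂_iff`).
  All [folklore].

## References
* [Pohlmann1968] H. Pohlmann, Algebraic cycles on abelian varieties of complex multiplication type, Ann. of Math. 88 (1968), Thm 1.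
* [Milne1999] J. S. Milne, Lefschetz motives and the Tate conjecture, Compositio Math. 117 (1999), Prop. 2.1, p. 54.
-/

namespace Summit.HodgeConjecture.CorCM.Census.OcticTwist

open Finset
open Summit.HodgeConjecture.CorCM.Census.QuarticTwist

variable (B : Type) [AddGroup B] [Fintype B] [DecidableEq B]

/-! ## §1 The joined functional `(f, block parities)` -/

/-- The half-parity joined with the block parities: `m ↦ (f(m), (P_ω(m))_ω)` on `Option (Orb₂ B)`. [folklore] -/
noncomputable def parF₂ (b₀ : B) (c : Ty₂ B → ZMod 2) : (Ty₂ B → ℤ) →ₗ[ℤ] (Option (Orb₂ B) → ZMod 2) where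
  toFun m := fun x => Option.elim x (fpar₂ B b₀ c m) (fun ω => parVec₂ B m ω)
  map_add' m m' := by
    funext x; rcases x with _ | ω
    · show fpar₂ B b₀ c (m + m') = fpar₂ B b₀ c m + fpar₂ B b₀ c m'
      exact map_add _ _ _
    · show parVec₂ B (m + m') ω = parVec₂ B m ω + parVec₂ B m' ω
      rw [map_add]; rfl
  map_smul' a m := by
    funext x; rcases x with _ | ω
    · show fpar₂ B b₀ c (a • m) = a • fpar₂ B b₀ c m
      exact map_smul _ _ _
    · show parVec₂ B (a • m) ω = a • parVec₂ B m ω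
      rw [map_smul]; rfl

/-- `parF₂` at `none` is `fpar₂`. [folklore] -/
theorem parF₂_apply_none (b₀ : B) (c : Ty₂ B → ZMod 2) (m : Ty₂ B → ℤ) : parF₂ B b₀ c m none = fpar₂ B b₀ c m := rfl

/-- `parF₂` at `some ω` is the block parity. [folklore] -/
theorem parF₂_apply_some (b₀ : B) (c : Ty₂ B → ZMod 2) (m : Ty₂ B → ℤ) (ω : Orb₂ B) : parF₂ B b₀ c m (some ω) = parVec₂ B m ω := rfl

/-- **The `(f, parities)` of `pairs₂ ⊔ ℤ[G]·S` lie in the `𝔽₂`-span of those of `S`, for `S ⊆ hodge₂`.** [folklore] -/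
theorem parF₂_mem_span_of_mem {c : Ty₂ B → ZMod 2}
    (hc : ∀ (e : Bool) (h : ZMod 4 × B) (T : Ty₂ B), c (act B e h T) = c T + (if e then 1 else 0)) {b₀ : B}
    (S : Finset (Ty₂ B → ℤ)) (hSH : ∀ v ∈ S, v ∈ hodge₂ B) {m : Ty₂ B → ℤ} (hm : m ∈ pairs₂ B ⊔ spanMot B S) :
    parF₂ B b₀ c m ∈ Submodule.span (ZMod 2) ((S.image (parF₂ B b₀ c) : Finset _) : Set (Option (Orb₂ B) → ZMod 2)) := by
  classical
  set T := Submodule.span (ZMod 2) ((S.image (parF₂ B b₀ c) : Finset _) : Set (Option (Orb₂ B) → ZMod 2)) with hT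
  have hle : pairs₂ B ⊔ spanMot B S ≤ (T.restrictScalars ℤ).comap (parF₂ B b₀ c) := by
    refine sup_le (Submodule.span_le.mpr ?_) (Submodule.span_le.mpr ?_)
    · rintro _ ⟨ψ, rfl⟩
      show parF₂ B b₀ c (pairVec₂ B ψ) ∈ T
      have e : parF₂ B b₀ c (pairVec₂ B ψ) = 0 := by
        funext x; rcases x with _ | ω
        · exact fpar₂_pairVec₂ B hc b₀ ψ
        · exact congrFun (parVec₂_pairVec₂ B ψ) ω
      rw [e]; exact T.zero_mem
    · rintro _ ⟨e, g, v, hv, rfl⟩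
      show parF₂ B b₀ c (transl₂ B e g v) ∈ T
      have e' : parF₂ B b₀ c (transl₂ B e g v) = parF₂ B b₀ c v := by
        funext x; rcases x with _ | ω
        · exact fpar₂_transl₂_of_mem_hodge₂ B hc b₀ e g (hSH v hv)
        · exact congrFun (parVec₂_transl₂ B e g v) ω
      rw [e']
      exact Submodule.subset_span (Finset.mem_coe.mpr (Finset.mem_image_of_mem _ hv))
  exact hle hm

/-! ## §2 The floor without screw pair types, even case -/

/-- For `|B|` even the Weil lift `w_1 ⊗ e_0` is invisible to every block parity. [folklore] -/
theorem parVec₂_W_even (hev : Even (Fintype.card B)) (b₀ : B) (ω : Orb₂ B) :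
    parVec₂ B (tens B (Wvec B 1) (Pi.single (cst B 0) 1)) ω = 0 := by
  have hodd2 : (Fintype.card B : ZMod 2) = 0 := by
    obtain ⟨m, hm⟩ := hev
    rw [hm]; push_cast
    have e : ∀ x : ZMod 2, x + x = 0 := by decide
    exact e _
  unfold Wvec
  rw [tens_sub_left, tens_sub_left, tens_smul_left, tens_sum_left]
  simp only [← single_eq_tens]
  rw [map_sub, map_sub, map_smul, map_sum, Pi.sub_apply, Pi.sub_apply, Pi.smul_apply, Finset.sum_apply]
  simp only [parVec₂_single_one, mk_atom_cst B b₀, mk_cst_cst, zero_sub, sub_zero]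
  rw [Finset.sum_const, Finset.card_univ, nsmul_eq_mul, hodd2, zero_mul, zero_sub, zsmul_eq_mul]
  push_cast
  rw [hodd2, zero_sub, show (1 : ZMod 4) - 1 = 0 by decide, show (-(1 : ZMod 4)) = -0 - 1 by decide, ← blkC_eq_blkC_neg]
  have neg2 : ∀ y : ZMod 2, -y = y := by decide
  rw [neg2, neg2, one_mul]
  have e : ∀ x : ZMod 2, x - x = 0 := fun x => sub_self x
  exact e _

/-- **THE FLOOR WITHOUT SCREW PAIR TYPES, even case** (`|B|` even `≥ 4`).  If `B` has no screw pair type and a finite family `S` of octic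
HODGE vectors generates `hodge₂` together with the octic pairs and all motions, then `β ≤ |S| + 1`. [folklore] -/
theorem card_orb₂_le_card_add_one_of_noScrew_even (hev : Even (Fintype.card B)) (h3 : 3 ≤ Fintype.card B)
    (hns : ∀ (T : Ty₂ B) (h : ZMod 4 × B), act B true h T ≠ T) (S : Finset (Ty₂ B → ℤ)) (hSH : ∀ v ∈ S, v ∈ hodge₂ B)
    (hS : hodge₂ B ≤ pairs₂ B ⊔ spanMot B S) : Fintype.card (Orb₂ B) ≤ S.card + 1 := by
  classical
  obtain ⟨b₀⟩ : Nonempty B := Fintype.card_pos_iff.mp (by omega)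
  obtain ⟨c, hc⟩ := exists_parity₂ B hns
  set T := Submodule.span (ZMod 2) ((S.image (parF₂ B b₀ c) : Finset _) : Set (Option (Orb₂ B) → ZMod 2)) with hT
  have hT' : Module.finrank (ZMod 2) T ≤ S.card := (finrank_span_finset_le_card _).trans Finset.card_image_le
  let NRt := {ω : Orb₂ B // 2 ≤ potOrb B ω}
  have hrep : ∀ ω : NRt, 2 ≤ pot B ω.1.out := by
    intro ω
    have h := ω.2
    rw [← Quotient.out_eq ω.1, potOrb_mk] at h
    exact h
  choose T₁ T₂ T₃ hF hP₁ hP₂ hP₃ using fun ω : NRt => exists_rel B h3 ω.1.out (hrep ω)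
  have cast3 : (∀ r : Fin 3, ((r : ℕ) : ZMod 4) ≠ -1) ∧ (∀ r r' : Fin 3, ((r : ℕ) : ZMod 4) = ((r' : ℕ) : ZMod 4) → r = r') := by
    refine ⟨by decide, by decide⟩
  -- the index type and the vectors: relations, Boolean lifts, three D-moves, the constant square (`false`) and the Weil lift (`true`)
  let vec : NRt ⊕ (ZMod 4 ⊕ (Fin 3 ⊕ Bool)) → (Ty₂ B → ℤ) := fun x =>
    match x with
    | Sum.inl ω => Pi.single ω.1.out 1 - Pi.single (T₁ ω) 1 - Pi.single (T₂ ω) 1 + Pi.single (T₃ ω) 1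
    | Sum.inr (Sum.inl t) => tens B (Xvec B (t + 1) b₀) (Pi.single (cst B 0) 1)
    | Sum.inr (Sum.inr (Sum.inl r)) =>
        tens B (Pi.single (atom B (((r : ℕ) : ZMod 4) + 1) b₀ (-1)) 1 - Pi.single (cst B (((r : ℕ) : ZMod 4) + 1)) 1)
          (Pi.single (cst B 0) 1 - Pi.single (cst B (((r : ℕ) : ZMod 4) + 1)) 1)
    | Sum.inr (Sum.inr (Sum.inr false)) =>
        tens B (Pi.single (cst B 1) 1 - Pi.single (cst B 0) 1) (Pi.single (cst B 1) 1 - Pi.single (cst B 0) 1)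
    | Sum.inr (Sum.inr (Sum.inr true)) => tens B (Wvec B 1) (Pi.single (cst B 0) 1)
  have hvecH : ∀ x, vec x ∈ hodge₂ B := by
    rintro (ω | t | r | (_ | _))
    · exact mem_hodge₂_of_isFace₂ B (hF ω)
    · exact tens_mem_hodge₂_left B (Xvec_mem B _ b₀) (sum_Xvec B _ b₀) _
    · exact tens_mem_hodge₂_of_sum_eq_zero B (sum_single_sub_single B _ _) (sum_single_sub_single B _ _)
    · exact tens_mem_hodge₂_of_sum_eq_zero B (sum_single_sub_single B _ _) (sum_single_sub_single B _ _)
    · exact tens_mem_hodge₂_left B (Wvec_mem B _) (sum_Wvec B _) _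
  have hmem : ∀ x, parF₂ B b₀ c (vec x) ∈ T := fun x => parF₂_mem_span_of_mem B hc S hSH (hS (hvecH x))
  -- block parity formulas
  have vX : ∀ (t : ZMod 4) (ω : Orb₂ B), parVec₂ B (vec (Sum.inr (Sum.inl t))) ω =
      (if ω = blkA B b₀ t 1 then 1 else 0) + (if ω = blkA B b₀ (t + 1) (-1) then 1 else 0)
        + (if ω = blkC B (-(t + 1)) then 1 else 0) + (if ω = blkC B (-(t + 1) - 1) then 1 else 0) := by
    intro t ω
    show parVec₂ B (tens B (Xvec B (t + 1) b₀) (Pi.single (cst B 0) 1)) ω = _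
    rw [parVec₂_X B b₀, add_sub_cancel_right]
  have vD : ∀ (r : Fin 3) (ω : Orb₂ B), parVec₂ B (vec (Sum.inr (Sum.inr (Sum.inl r)))) ω =
      (if ω = blkA B b₀ ((r : ℕ) : ZMod 4) (-1) then 1 else 0) + (if ω = blkA B b₀ (-1) (-1) then 1 else 0)
        + (if ω = blkC B (0 - (((r : ℕ) : ZMod 4) + 1)) then 1 else 0) + (if ω = blkC B 0 then 1 else 0) := by
    intro r ω
    show parVec₂ B (tens B (Pi.single (atom B (((r : ℕ) : ZMod 4) + 1) b₀ (-1)) 1 - Pi.single (cst B (((r : ℕ) : ZMod 4) + 1)) 1)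
      (Pi.single (cst B 0) 1 - Pi.single (cst B (((r : ℕ) : ZMod 4) + 1)) 1)) ω = _
    rw [parVec₂_Dmove B b₀, show ((r : ℕ) : ZMod 4) + 1 - 0 - 1 = ((r : ℕ) : ZMod 4) by ring,
      show ((r : ℕ) : ZMod 4) + 1 - (((r : ℕ) : ZMod 4) + 1) - 1 = -1 by ring, sub_self]
  have vC : ∀ ω : Orb₂ B, parVec₂ B (vec (Sum.inr (Sum.inr (Sum.inr false)))) ω =
      (if ω = blkC B (-1) then 1 else 0) + (if ω = blkC B 1 then 1 else 0) := fun ω => parVec₂_ccSquare B ω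
  have vW : ∀ ω : Orb₂ B, parVec₂ B (vec (Sum.inr (Sum.inr (Sum.inr true)))) ω = 0 := fun ω => parVec₂_W_even B hev b₀ ω
  have fW : fpar₂ B b₀ c (vec (Sum.inr (Sum.inr (Sum.inr true)))) = 1 := fpar₂_W B hc hev b₀
  have resA : ∀ (ω : NRt) (ρ k : ZMod 4), (k = 1 ∨ k = -1) → (ω.1 : Orb₂ B) ≠ blkA B b₀ ρ k := by
    intro ω ρ k hk h
    have := (potOrb_blk B h3 b₀ 0 ρ hk).2
    have h2 := ω.2
    rw [h] at h2
    omega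
  have resC : ∀ (ω : NRt) (d : ZMod 4), (ω.1 : Orb₂ B) ≠ blkC B d := by
    intro ω d h
    have := (potOrb_blk B h3 b₀ d 0 (Or.inl rfl)).1
    have h2 := ω.2
    rw [h] at h2
    omega
  have m1 : (-1 : ZMod 4) = 1 ∨ (-1 : ZMod 4) = -1 := Or.inr rfl
  have p1 : (1 : ZMod 4) = 1 ∨ (1 : ZMod 4) = -1 := Or.inl rfl
  have AA : ∀ (ρ ρ' k k' : ZMod 4), k ≠ 0 → (blkA B b₀ ρ k = blkA B b₀ ρ' k' ↔ ρ = ρ' ∧ k = k') :=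
    fun ρ ρ' k k' hk => blkA_eq_blkA_iff B h3 b₀ hk
  have AC : ∀ (ρ k d : ZMod 4), k ≠ 0 → blkA B b₀ ρ k ≠ blkC B d :=
    fun ρ k d hk => blkA_ne_blkC B h3 b₀ ρ hk d
  have CC : ∀ d d' : ZMod 4, blkC B d = blkC B d' ↔ d = d' ∨ d = -d' - 1 := fun d d' => blkC_eq_blkC_iff B d d'
  have k1 : (1 : ZMod 4) ≠ 0 := by decide
  have km : (-1 : ZMod 4) ≠ 0 := by decide
  -- linear independence of the `(f, parities)`-values
  have hli : LinearIndependent (ZMod 2) (fun x => parF₂ B b₀ c (vec x)) := by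
    rw [Fintype.linearIndependent_iff]
    intro g hsum
    -- evaluation at a block
    have heval : ∀ ω : Orb₂ B, (∑ ωn : NRt, g (Sum.inl ωn) * parVec₂ B (vec (Sum.inl ωn)) ω)
        + ((∑ t : ZMod 4, g (Sum.inr (Sum.inl t)) * parVec₂ B (vec (Sum.inr (Sum.inl t))) ω)
          + ((∑ r : Fin 3, g (Sum.inr (Sum.inr (Sum.inl r))) * parVec₂ B (vec (Sum.inr (Sum.inr (Sum.inl r)))) ω)
            + (g (Sum.inr (Sum.inr (Sum.inr true))) * parVec₂ B (vec (Sum.inr (Sum.inr (Sum.inr true)))) ω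
              + g (Sum.inr (Sum.inr (Sum.inr false))) * parVec₂ B (vec (Sum.inr (Sum.inr (Sum.inr false)))) ω))) = 0 := by
      intro ω
      have h := congrFun hsum (some ω)
      rw [Finset.sum_apply, Fintype.sum_sum_type, Fintype.sum_sum_type, Fintype.sum_sum_type, Fintype.sum_bool] at h
      simp only [Pi.smul_apply, smul_eq_mul, Pi.zero_apply, parF₂_apply_some] at h
      exact h
    -- (a) the non-residual coefficients vanish
    have hnr : ∀ ωn : NRt, g (Sum.inl ωn) = 0 := by
      by_contra hne
      obtain ⟨ω₁, hω₁⟩ := not_forall.mp hne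
      obtain ⟨ω₀, hω₀, hmax⟩ := Finset.exists_max_image (univ.filter fun ωn : NRt => g (Sum.inl ωn) ≠ 0)
        (fun ωn => potOrb B ωn.1) ⟨ω₁, mem_filter.mpr ⟨mem_univ _, hω₁⟩⟩
      have hg₀ : g (Sum.inl ω₀) ≠ 0 := (mem_filter.mp hω₀).2
      have hs₀ : ω₀.1.out ∈ orbSet₂ B ω₀.1 := (mem_orbSet₂ B).mpr (Quotient.out_eq _)
      have h := heval ω₀.1
      rw [vW, vC, if_neg (resC ω₀ (-1)), if_neg (resC ω₀ 1), add_zero, mul_zero, mul_zero, add_zero] at h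
      have hXz : ∀ t : ZMod 4, g (Sum.inr (Sum.inl t)) * parVec₂ B (vec (Sum.inr (Sum.inl t))) ω₀.1 = 0 := by
        intro t
        rw [vX, if_neg (resA ω₀ t 1 p1), if_neg (resA ω₀ (t + 1) (-1) m1), if_neg (resC ω₀ _), if_neg (resC ω₀ _), add_zero,
          add_zero, add_zero, mul_zero]
      have hDz : ∀ r : Fin 3, g (Sum.inr (Sum.inr (Sum.inl r))) * parVec₂ B (vec (Sum.inr (Sum.inr (Sum.inl r)))) ω₀.1 = 0 := by
        intro r
        rw [vD, if_neg (resA ω₀ _ (-1) m1), if_neg (resA ω₀ (-1) (-1) m1), if_neg (resC ω₀ _), if_neg (resC ω₀ _), add_zero,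
          add_zero, add_zero, mul_zero]
      rw [Finset.sum_eq_zero (fun t _ => hXz t), Finset.sum_eq_zero (fun r _ => hDz r), zero_add, add_zero, add_zero] at h
      have hterm : ∀ ωn : NRt, g (Sum.inl ωn) * parVec₂ B (vec (Sum.inl ωn)) ω₀.1 = if ωn = ω₀ then g (Sum.inl ω₀) else 0 := by
        intro ωn
        by_cases hgn : g (Sum.inl ωn) = 0
        · rw [hgn, zero_mul]; split_ifs with h' <;> [rw [← h', hgn]; rfl]
        · have hle : potOrb B ωn.1 ≤ potOrb B ω₀.1 := hmax ωn (mem_filter.mpr ⟨mem_univ _, hgn⟩)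
          have hpot : pot B ωn.1.out ≤ potOrb B ω₀.1 := by rw [← Quotient.out_eq ωn.1, potOrb_mk] at hle; exact hle
          rw [show vec (Sum.inl ωn) = Pi.single ωn.1.out 1 - Pi.single (T₁ ωn) 1 - Pi.single (T₂ ωn) 1 + Pi.single (T₃ ωn) 1
              from rfl, parVec₂_rel B (hP₁ ωn) (hP₂ ωn) (hP₃ ωn) ω₀.1 hpot]
          by_cases hωω : ωn = ω₀
          · subst hωω; rw [if_pos hs₀, if_pos rfl, mul_one]
          · have hnot : ωn.1.out ∉ orbSet₂ B ω₀.1 := by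
              intro hin
              exact hωω (Subtype.ext (((mem_orbSet₂ B).mp hin).symm ▸ (Quotient.out_eq ωn.1).symm ▸ rfl))
            rw [if_neg hnot, if_neg hωω, mul_zero]
      rw [Finset.sum_congr rfl (fun ωn _ => hterm ωn), Finset.sum_ite_eq' univ ω₀, if_pos (mem_univ _)] at h
      exact hg₀ h
    have hrest : ∀ ω : Orb₂ B, (∑ t : ZMod 4, g (Sum.inr (Sum.inl t)) * parVec₂ B (vec (Sum.inr (Sum.inl t))) ω)
        + ((∑ r : Fin 3, g (Sum.inr (Sum.inr (Sum.inl r))) * parVec₂ B (vec (Sum.inr (Sum.inr (Sum.inl r)))) ω)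
          + g (Sum.inr (Sum.inr (Sum.inr false))) * parVec₂ B (vec (Sum.inr (Sum.inr (Sum.inr false)))) ω) = 0 := by
      intro ω
      have h := heval ω
      rw [Finset.sum_eq_zero (fun ωn _ => by rw [hnr ωn, zero_mul]), zero_add, vW, mul_zero, zero_add] at h
      exact h
    -- (b) the Boolean lifts: evaluate at `A(ρ, +1)`
    have hX : ∀ t : ZMod 4, g (Sum.inr (Sum.inl t)) = 0 := by
      intro ρ
      have h := hrest (blkA B b₀ ρ 1)
      have hXt : ∀ t : ZMod 4, g (Sum.inr (Sum.inl t)) * parVec₂ B (vec (Sum.inr (Sum.inl t))) (blkA B b₀ ρ 1)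
          = if ρ = t then g (Sum.inr (Sum.inl t)) else 0 := by
        intro t
        rw [vX, if_neg (AC ρ 1 (-(t + 1)) k1), if_neg (AC ρ 1 (-(t + 1) - 1) k1), add_zero, add_zero,
          if_neg (show ¬ blkA B b₀ ρ 1 = blkA B b₀ (t + 1) (-1) from fun h' => absurd ((AA _ _ _ _ k1).mp h').2 (by decide)),
          add_zero]
        by_cases hρt : ρ = t
        · rw [if_pos ((AA _ _ _ _ k1).mpr ⟨hρt, rfl⟩), if_pos hρt, mul_one]
        · rw [if_neg (fun h' => hρt ((AA _ _ _ _ k1).mp h').1), if_neg hρt, mul_zero]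
      have hDz : ∀ r : Fin 3, g (Sum.inr (Sum.inr (Sum.inl r))) * parVec₂ B (vec (Sum.inr (Sum.inr (Sum.inl r)))) (blkA B b₀ ρ 1) = 0 := by
        intro r
        rw [vD, if_neg (show ¬ blkA B b₀ ρ 1 = blkA B b₀ ((r : ℕ) : ZMod 4) (-1) from fun h' => absurd ((AA _ _ _ _ k1).mp h').2 (by decide)),
          if_neg (show ¬ blkA B b₀ ρ 1 = blkA B b₀ (-1) (-1) from fun h' => absurd ((AA _ _ _ _ k1).mp h').2 (by decide)),
          if_neg (AC ρ 1 _ k1), if_neg (AC ρ 1 0 k1), add_zero, add_zero, add_zero, mul_zero]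
      have hCz : g (Sum.inr (Sum.inr (Sum.inr false))) * parVec₂ B (vec (Sum.inr (Sum.inr (Sum.inr false)))) (blkA B b₀ ρ 1) = 0 := by
        rw [vC, if_neg (AC ρ 1 (-1) k1), if_neg (AC ρ 1 1 k1), add_zero, mul_zero]
      rw [Finset.sum_congr rfl (fun t _ => hXt t), Finset.sum_ite_eq univ ρ, if_pos (mem_univ _),
        Finset.sum_eq_zero (fun r _ => hDz r), hCz, add_zero, add_zero] at h
      exact h
    have hrest' : ∀ ω : Orb₂ B, (∑ r : Fin 3, g (Sum.inr (Sum.inr (Sum.inl r))) * parVec₂ B (vec (Sum.inr (Sum.inr (Sum.inl r)))) ω)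
        + g (Sum.inr (Sum.inr (Sum.inr false))) * parVec₂ B (vec (Sum.inr (Sum.inr (Sum.inr false)))) ω = 0 := by
      intro ω
      have h := hrest ω
      have hXz : ∑ t : ZMod 4, g (Sum.inr (Sum.inl t)) * parVec₂ B (vec (Sum.inr (Sum.inl t))) ω = 0 :=
        Finset.sum_eq_zero (fun t _ => by rw [hX t, zero_mul])
      rw [hXz, zero_add] at h
      exact h
    -- (c) the three D-moves: evaluate at `A(ρ, −1)`, `ρ = 0, 1, 2`
    have hD : ∀ r : Fin 3, g (Sum.inr (Sum.inr (Sum.inl r))) = 0 := by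
      intro r₀
      have h := hrest' (blkA B b₀ ((r₀ : ℕ) : ZMod 4) (-1))
      have hDt : ∀ r : Fin 3, g (Sum.inr (Sum.inr (Sum.inl r))) * parVec₂ B (vec (Sum.inr (Sum.inr (Sum.inl r))))
          (blkA B b₀ ((r₀ : ℕ) : ZMod 4) (-1)) = if r₀ = r then g (Sum.inr (Sum.inr (Sum.inl r))) else 0 := by
        intro r
        rw [vD, if_neg (show ¬ blkA B b₀ ((r₀ : ℕ) : ZMod 4) (-1) = blkA B b₀ (-1) (-1) from
            fun h' => cast3.1 r₀ ((AA _ _ _ _ km).mp h').1),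
          if_neg (AC _ (-1) _ km), if_neg (AC _ (-1) 0 km), add_zero, add_zero, add_zero]
        by_cases hrr : r₀ = r
        · subst hrr; rw [if_pos rfl, if_pos rfl, mul_one]
        · rw [if_neg (fun h' => hrr (cast3.2 r₀ r ((AA _ _ _ _ km).mp h').1)), if_neg hrr, mul_zero]
      have hCz : g (Sum.inr (Sum.inr (Sum.inr false))) * parVec₂ B (vec (Sum.inr (Sum.inr (Sum.inr false))))
          (blkA B b₀ ((r₀ : ℕ) : ZMod 4) (-1)) = 0 := by
        rw [vC, if_neg (AC _ (-1) (-1) km), if_neg (AC _ (-1) 1 km), add_zero, mul_zero]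
      rw [Finset.sum_congr rfl (fun r _ => hDt r), Finset.sum_ite_eq univ r₀, if_pos (mem_univ _), hCz, add_zero] at h
      exact h
    -- (d) the constant square: evaluate at `C(0)`
    have hC : g (Sum.inr (Sum.inr (Sum.inr false))) = 0 := by
      have h := hrest' (blkC B 0)
      have hDz : ∑ r : Fin 3, g (Sum.inr (Sum.inr (Sum.inl r))) * parVec₂ B (vec (Sum.inr (Sum.inr (Sum.inl r)))) (blkC B 0) = 0 :=
        Finset.sum_eq_zero (fun r _ => by rw [hD r, zero_mul])
      have yC3 : blkC B 0 = blkC B (-1) := (CC 0 (-1)).mpr (Or.inr (by decide))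
      have nC1 : ¬ blkC B 0 = blkC B 1 := fun h' => absurd ((CC 0 1).mp h') (by decide)
      rw [hDz, zero_add, vC, if_pos yC3, if_neg nC1, add_zero, mul_one] at h
      exact h
    -- (e) the Weil lift: evaluate the half-parity component
    have hW : g (Sum.inr (Sum.inr (Sum.inr true))) = 0 := by
      have h := congrFun hsum none
      rw [Finset.sum_apply, Fintype.sum_sum_type, Fintype.sum_sum_type, Fintype.sum_sum_type, Fintype.sum_bool] at h
      simp only [Pi.smul_apply, smul_eq_mul, Pi.zero_apply, parF₂_apply_none] at h
      rw [Finset.sum_eq_zero (fun ωn _ => by rw [hnr ωn, zero_mul]), Finset.sum_eq_zero (fun t _ => by rw [hX t, zero_mul]),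
        Finset.sum_eq_zero (fun r _ => by rw [hD r, zero_mul]), hC, zero_mul, fW, mul_one, zero_add, zero_add, zero_add, add_zero] at h
      exact h
    rintro (ω | t | r | (_ | _))
    · exact hnr ω
    · exact hX t
    · exact hD r
    · exact hC
    · exact hW
  -- count
  have hli' : LinearIndependent (ZMod 2) (fun x => (⟨_, hmem x⟩ : T)) := LinearIndependent.of_comp T.subtype hli
  have hcard := hli'.fintype_card_le_finrank
  simp only [Fintype.card_sum, ZMod.card, Fintype.card_fin, Fintype.card_bool] at hcard
  have hsplit : Fintype.card NRt + Fintype.card {ω : Orb₂ B // potOrb B ω ≤ 1} = Fintype.card (Orb₂ B) := card_blocks_split B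
  have hten := card_residual_blocks_le_ten B h3
  omega

/-! ## §3 The floor without screw pair types, any parity -/

/-- **THE FLOOR WITHOUT SCREW PAIR TYPES** (`|B| ≥ 3`, any parity): `β ≤ |S| + 1` for every generating family `S` of octic Hodge vectors. [folklore] -/
theorem card_orb₂_le_card_add_one_of_noScrew (h3 : 3 ≤ Fintype.card B) (hns : ∀ (T : Ty₂ B) (h : ZMod 4 × B), act B true h T ≠ T)
    (S : Finset (Ty₂ B → ℤ)) (hSH : ∀ v ∈ S, v ∈ hodge₂ B) (hS : hodge₂ B ≤ pairs₂ B ⊔ spanMot B S) :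
    Fintype.card (Orb₂ B) ≤ S.card + 1 := by
  rcases Nat.even_or_odd (Fintype.card B) with hev | hodd
  · exact card_orb₂_le_card_add_one_of_noScrew_even B hev h3 hns S hSH hS
  · exact card_orb₂_le_card_add_one B hodd h3 S hS

/-! ## §4 The law without elements of order divisible by eight -/

/-- **THE OCTIC-TWIST LAW WITHOUT ELEMENTS OF ORDER DIVISIBLE BY EIGHT** (every finite group `B`, `|B| ≥ 3`, `8 ∤ ord t` for all `t ∈ B`).
(i) A family of EXACTLY `β − 1` octic rank-four faces (octic Hodge vectors) generates `hodge₂` modulo `pairs₂` under the motions, and (ii) no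
family of fewer octic Hodge vectors does: `μ_hodge(ℤ/8 × B, (4,0)) = β − 1` EXACTLY. [folklore] -/
theorem octicTwist_law_noScrew (h3 : 3 ≤ Fintype.card B) (h8 : ∀ t : B, ¬ 8 ∣ addOrderOf t) :
    (∃ S : Finset (Ty₂ B → ℤ), (∀ f ∈ S, IsFace₂ B f) ∧ hodge₂ B ≤ pairs₂ B ⊔ spanMot B S ∧
        S.card + 1 = Fintype.card (Orb₂ B)) ∧
      ∀ S : Finset (Ty₂ B → ℤ), (∀ v ∈ S, v ∈ hodge₂ B) → hodge₂ B ≤ pairs₂ B ⊔ spanMot B S →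
        Fintype.card (Orb₂ B) ≤ S.card + 1 := by
  have hns : ∀ (T : Ty₂ B) (h : ZMod 4 × B), act B true h T ≠ T := fun T h hfix => h8 h.2 (eight_dvd_of_screw₂ B hfix)
  refine ⟨?_, fun S hSH hS => card_orb₂_le_card_add_one_of_noScrew B h3 hns S hSH hS⟩
  obtain ⟨S, hface, hgen, hcard⟩ := exists_faces_generate₂_all B h3
  exact ⟨S, hface, hgen, le_antisymm hcard
    (card_orb₂_le_card_add_one_of_noScrew B h3 hns S (fun f hf => mem_hodge₂_of_isFace₂ B (hface f hf)) hgen)⟩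

/-! ## §5 Screw pair types exist exactly when `B` has an element of order divisible by eight -/

omit [Fintype B] [DecidableEq B] in
/-- **An element of order divisible by `8` gives a screw pair type**: `T₀ = (ψ, (0,t)·ψ)` with `(1, 2t)·ψ = ψ` (gen 32ʼs quartic
`exists_screw` at `2t`, whose order is divisible by `4`) is fixed by the odd motion `act true (0,t)`.  With part XXIIʼs `eight_dvd_of_screw₂`:
screw pair types exist iff `∃ t ∈ B, 8 ∣ ord t` — the `δ` of the twist fibre law at `j = 2`. [folklore] -/
theorem exists_screw₂ {t : B} (h8 : 8 ∣ addOrderOf t) : ∃ (T : Ty₂ B) (h : ZMod 4 × B), act B true h T = T := by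
  have h4 : 4 ∣ addOrderOf (t + t) := by
    rw [← two_nsmul, addOrderOf_nsmul' t two_ne_zero]
    obtain ⟨q, hq⟩ := h8
    rw [hq, Nat.gcd_eq_right ⟨4 * q, by ring⟩]
    exact ⟨q, by omega⟩
  obtain ⟨ψ, hψ⟩ := exists_screw B h4
  refine ⟨(ψ, tw B (0, t) ψ), (0, t), ?_⟩
  rw [act_true]
  show (tw B (0, t) (tw B (1, 0) (tw B (0, t) ψ)), tw B (0, t) ψ) = (ψ, tw B (0, t) ψ)
  rw [tw_tw, tw_tw]
  have e : (((0 : ZMod 4), t) + ((1 : ZMod 4), (0 : B)) + ((0 : ZMod 4), t)) = ((1 : ZMod 4), t + t) :=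
    Prod.ext (by simp) (by simp)
  rw [e, hψ]

omit [DecidableEq B] in
/-- **Screw pair types exist iff `B` has an element of order divisible by `8`.** [folklore] -/
theorem screw₂_iff : (∃ (T : Ty₂ B) (h : ZMod 4 × B), act B true h T = T) ↔ ∃ t : B, 8 ∣ addOrderOf t :=
  ⟨fun ⟨_, h, hfix⟩ => ⟨h.2, eight_dvd_of_screw₂ B hfix⟩, fun ⟨_, h8⟩ => exists_screw₂ B h8⟩

end Summit.HodgeConjecture.CorCM.Census.OcticTwist
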